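import Summits.BirchSwinnertonDyer.BirchSwinnertonDyer.Theorems.SchneiderFreeAdditiveX3UpperWingGordOfKYRead
import HarnessLib

/-!
# Route `SchneiderFreeAdditiveX3` (K1 door) + its second wing ON THE (G-ord, `e = 2`) CELL ALONE: the FULL rank-one
# residue of X3♯ (`MissingPPartAt`, both halves of BSD_p) on 2 560 pairs from NAMED inputs only — no (M)-cell crux,
# no (M) co-socket; the only socket-shaped binder left is the twist-unit certificate `hTU`

Cell `bsd-schneider-ideate`, seat `bsd-schneider-door-c5` (prover, generation 9). The route's leaf and the door's
lower assembly (`additiveX3RankOneLower_of_printedFacts_of_pt_of_branchIMCs`, door-c4 gen 4) are CLASS-LEVEL over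
both cells, so every "(G-ord) only" reading so far still carried the (M) crux `PotMultBranchIMC` (r2, NONE in print).
The lower glue is per pair (`stepLManin_of_pt_of_kolyvagin_of_branchIMCs` splits on the cell), so:

* §1 `missingLowerBoundAt_gordTwo_of_printedFacts_of_pt_of_gordTwoBranchIMC` — the LOWER half on the (G-ord, `e = 2`)
  cell from `PrintedFacts`, Poitou–Tate Selmer-structure duality and crux r3 `GordTwoBranchIMC` ALONE (door-c4 gen 4's
  leaf proof restricted to the cell: STEP L at the 19183 datum from the r3 socket + the control inequality, then
  `JointLowerManin` / `PartnerUpperRankZero` / `HeegnerTwistData` by their tree proofs).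
* §2 `missingLowerBoundAt_gordTwo_of_KYRead` — the same ⇐ `PrintedFacts`, `ControlFacts`, the rebased facts,
  `thm351_OPEN` (PRE), `KYReadCH`, `KYReadSliver` (door-c3 gen 8's H-record `gordTwoBranchIMC_of_KYRead`).
* §3 `missingPPartAt_gordTwo_of_KYRead_of_twistUnitField` — **BOTH halves on the (G-ord, `e = 2`) cell**:
  `PrintedFacts → ControlFacts → RebasedFactsG → thm351_OPEN → KYReadCH → KYReadSliver → KYReadCHUnit →
  KYReadSliverUpper → hTU(split, on the cell) → ∀ (W, p) on the cell with r_an = 1, MissingPPartAt W p` — §2 + this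
  seat's `Upper.missingUpperBoundAt_gordTwo_of_KYRead_of_twistUnitField` (p492691). Every input is a NAMED Prop of
  the tree except `hTU` (per-pair certificate / class-wide `TwistUnitX3Split`).

HONEST FRAMING: CONDITIONAL on every displayed hypothesis (`thm351_OPEN` is an unrefereed-preprint claim; `KYReadCH` /
`KYReadCHUnit` are untyped readings of CH18, the latter strengthened to a unit cofactor; the two slivers are outside
print and census-void; `hTU` is a certificate per pair); closes no item; BSD is NOT advanced beyond this reduction.

References: [JetchevSkinnerWan2017] §7.4.1; [KellerYin2024b] arXiv:2410.23241 Thm. 3.5.1; [CastellaHsieh2018] Thm. 5.7,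
Lemma 5.4; [Miller2011LMS] Def. 1.1; [GrossZagier1986] I.(6.3), (7.3); [MilneADT2006] I 4.10; [KrizLi2019] Thm. 1.20.
-/

noncomputable section

open scoped Classical

open Field NumberField IsDedekindDomain WeierstrassCurve
open Literature.NumberTheory.EllipticCurves Literature.NumberTheory.EllipticCurves.GreenbergSelmer
open Literature.NumberTheory.GaloisRepresentations
open Literature.NumberTheory.GaloisCohomology
open Literature.NumberTheory.EllipticCurves.ModularForms
  Literature.NumberTheory.EllipticCurves.CaiShuTian2014
  Literature.NumberTheory.EllipticCurves.KellerYin2024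
  Literature.NumberTheory.EllipticCurves.Rank1Residual
  Literature.NumberTheory.EllipticCurves.Rank1Residual.Typed
  Summit.BirchSwinnertonDyer.Rank1Residual
  Summit.BirchSwinnertonDyer.Rank1Residual.X11b
  Summit.BirchSwinnertonDyer.BirchSwinnertonDyer.Theorems.SchneiderFree
  Summit.BirchSwinnertonDyer.BirchSwinnertonDyer.Theorems.SchneiderFree.KYRead
  Summit.BirchSwinnertonDyer.BirchSwinnertonDyer.Theorems.SchneiderFreeControlAtoms
  Summit.BirchSwinnertonDyer.BirchSwinnertonDyer.Theses.SchneiderFreeAdditiveX3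

set_option linter.dupNamespace false
set_option autoImplicit false

namespace Summit.BirchSwinnertonDyer.BirchSwinnertonDyer.Theorems.SchneiderFreeAdditiveX3

/-! ## §1 The LOWER half on the (G-ord, `e = 2`) cell from crux r3 alone -/

/-- **The door's lower half on the (G-ord, `e = 2`) cell from `PrintedFacts`, Poitou–Tate duality and
`GordTwoBranchIMC` alone** (no (M) crux): door-c4 gen 4's `additiveX3RankOneLower_of_printedFacts_of_pt_of_branchIMCs`
restricted to `SubGordTwo` — STEP L at the Heegner/twist datum of `HeegnerTwistData` (19183) from the r3 socket at every
frame (`indexLowerBoundLeAt_of_frames_of_shaFinite_le` with the control INEQUALITY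
`additiveControlLeOnTreeAt_of_pt_of_kolyvagin`), then `JointLowerManin` (19180) and `PartnerUpperRankZero` (19181) by
their tree proofs. CONDITIONAL on `GordTwoBranchIMC` and the named facts; nothing asserted about BSD.
[cite: JetchevSkinnerWan2017, §7.4.1 (arXiv:1512.06894 p. 30)] [cite: MilneADT2006, Ch. I, Thm. 4.10] -/
theorem missingLowerBoundAt_gordTwo_of_printedFacts_of_pt_of_gordTwoBranchIMC (hF : PrintedFacts)
    (hPT : ∀ (K : Type) [Field K] [NumberField K], poitouTate_selmerStructure_duality K)
    (h3 : GordTwoBranchIMC) :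
    ∀ (W : WeierstrassCurve ℚ) [W.IsElliptic] [W.IsGloballyMinimal] (p : ℕ) [Fact p.Prime],
      W.analyticRank = 1 → p ≠ 2 → ClassX3 W p → Additive.SubGordTwo W p → MissingLowerBoundAt W p := by
  have hKd : HeegnerTwistData := schneiderFreeAdditiveX3_heegnerTwistData_proof
  have hJ : JointLowerManin := schneiderFreeAdditiveX3_jointLowerManin_proof
  have hU : PartnerUpperRankZero := schneiderFreeAdditiveX3_partnerUpperRankZero_proof
  obtain ⟨hGZ, hKo, hGZK, hmod, hmodD, hCas, hGZ73, hFH, hpar, hHP, hDel, hW16, hWu⟩ := hF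
  intro W _ _ p _ hr hp2 hX hG
  have hS : Additive.SubSemistableTwist W p := Or.inr hG
  -- the Heegner/twist datum of the door (item 19183, CLOSED)
  have hdata : HeegnerTwistDataManinAt W p := hKd hFH hpar hHP hGZ hmod hmodD W p hr hp2 hX hS
  obtain ⟨N, _, K, _, _, Dt, H, ι, P, Wd, _, _, hN, hKiq, hodd, hunit, hHe, hLtw, hP, hnt, hWd,
    hrd, hXd, hSd⟩ := hdata
  have hloc : Additive.N10.Locus W p :=
    (Additive.N10.locus_iff_cells W p).mpr
      ((Additive.N10.cellM_or_cellGordTwo_of_classX3_of_subSemistableTwist W p hp2 hX hS).elim Or.inl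
        (fun h ↦ Or.inr (Or.inl h)))
  -- STEP L at the datum: the r3 socket at every frame + the control inequality (PT duality + Kolyvagin)
  have hfin : (W.baseChange K).ShaFinite := (hKo N W K hKiq hHe ⟨Dt, H, ι, hP⟩ hnt).2
  have hidx : IndexLowerBoundLeAt W p K P (padicValNat p Dt.c.natAbs) := by
    refine indexLowerBoundLeAt_of_frames_of_shaFinite_le hloc hN hKiq hHe hfin ?_ ?_
    · intro κ hκ γ _ 𝔭 h𝔭 he hf
      exact h3 W p hr hp2 hX hG N K Dt H ι P hr hloc hN hKiq hodd hunit hHe hLtw hP hnt κ hκ γ 𝔭 h𝔭 he hf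
    · intro κ hκ γ _ 𝔭 h𝔭 he hf
      exact additiveControlLeOnTreeAt_of_pt_of_kolyvagin hPT hKo W p hr hp2 hX hS N K Dt H ι P hr hloc hN
        hKiq hodd hunit hHe hLtw hP hnt κ hκ γ 𝔭 h𝔭 he hf
  -- Gross–Zagier bookkeeping (19180) and the partner's upper half (19181)
  have hJ' : JointLowerBoundAt W Wd p :=
    hJ hGZ hKo hGZK hmod hmodD hCas hGZ73 W p N K Dt H ι P Wd hr hN hKiq hodd hunit hHe hLtw hP hnt hWd
      hrd hp2 hidx
  exact missingLowerBoundAt_of_joint_of_upper hJ' (hU hDel hGZK hmod hmodD hW16 hWu Wd p hrd hp2 hXd hSd)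

/-! ## §2 The LOWER half on the cell from the KY-read inputs (door-c3 gen 8's H-record) -/

/-- **The lower half on the (G-ord, `e = 2`) cell ⇐ `PrintedFacts` ∧ `ControlFacts` ∧ the rebased facts ∧
`thm351_OPEN` ∧ `KYReadCH` ∧ `KYReadSliver`** — §1 with `GordTwoBranchIMC` supplied by door-c3 gen 8's
`gordTwoBranchIMC_of_KYRead` (p487553). CONDITIONAL; nothing asserted about BSD.
[cite: KellerYin2024b, Thm. 3.5.1 (arXiv:2410.23241 p. 20) (preprint; hypothesis)]
[cite: CastellaHsieh2018, Thm. 5.7 and Lemma 5.4 (shape of KYReadCH)] -/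
theorem missingLowerBoundAt_gordTwo_of_KYRead (hF : PrintedFacts) (hCF : ControlFacts)
    (hR : Gross2004.rankinLSeries_eq_mul_quadraticTwist ∧ phi_heegnerPointOfConductor_mem_ringClassField ∧
      thm11_ringClassChar)
    (hKY : thm351_imc_isTorsion_mu_zero_charIdeal_eq_OPEN) (hCH : KYReadCH) (hSl : KYReadSliver) :
    ∀ (W : WeierstrassCurve ℚ) [W.IsElliptic] [W.IsGloballyMinimal] (p : ℕ) [Fact p.Prime],
      W.analyticRank = 1 → p ≠ 2 → ClassX3 W p → Additive.SubGordTwo W p → MissingLowerBoundAt W p :=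
  missingLowerBoundAt_gordTwo_of_printedFacts_of_pt_of_gordTwoBranchIMC hF hCF.1
    (gordTwoBranchIMC_of_KYRead hF hCF hR hKY hCH hSl)

/-! ## §3 BOTH halves on the (G-ord, `e = 2`) cell from NAMED inputs + the twist-unit certificate -/

/-- **FULL BSD_p residue (`MissingPPartAt`: `ord_p #Ш(E)_an = ord_p #Ш(E)`) on the (G-ord, `e = 2`) cell of the door
(2 560 pairs) from NAMED inputs only.** `PrintedFacts → ControlFacts → RebasedFactsG → thm351_OPEN (Keller–Yin Thm.
3.5.1, PREPRINT: BOTH halves of its equality are used — `⊇` with `μ = 0` by the door, `⊆` μ-free by the wing) →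
KYReadCH → KYReadSliver (door) → KYReadCHUnit → KYReadSliverUpper (wing) → hTU (the SPLIT twist-unit datum on the
cell) → ∀ (W, p) on the cell with r_an = 1, MissingPPartAt W p`. §2 + `Upper.missingUpperBoundAt_gordTwo_of_KYRead_of_twistUnitField`.
No (M)-cell input. CONDITIONAL on every displayed hypothesis; closes no item; BSD NOT advanced beyond this typed reduction.
[cite: JetchevSkinnerWan2017, §7.4.1 (arXiv:1512.06894 p. 30)] [cite: Miller2011LMS, Def. 1.1]
[cite: KellerYin2024b, Thm. 3.5.1 (arXiv:2410.23241 p. 20) (preprint; hypothesis)]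
[cite: CastellaHsieh2018, Thm. 5.7 and Lemma 5.4 (arXiv:1505.08165 pp. 17–19) (shapes of KYReadCH / KYReadCHUnit)]
[cite: KrizLi2019, Thm. 1.20 (shape of hTU)] -/
theorem missingPPartAt_gordTwo_of_KYRead_of_twistUnitField (hF : PrintedFacts) (hCF : ControlFacts)
    (hR : Gross2004.rankinLSeries_eq_mul_quadraticTwist ∧ phi_heegnerPointOfConductor_mem_ringClassField ∧
      thm11_ringClassChar)
    (hKY : thm351_imc_isTorsion_mu_zero_charIdeal_eq_OPEN) (hCH : KYReadCH) (hSl : KYReadSliver)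
    (hCHu : KYReadCHUnit) (hSlU : KYReadSliverUpper)
    (hTU : ∀ (W : WeierstrassCurve ℚ) [W.IsElliptic] [W.IsGloballyMinimal] (p : ℕ) [Fact p.Prime],
      W.analyticRank = 1 → p ≠ 2 → ClassX3 W p → Additive.SubGordTwo W p → Upper.TwistUnitFieldAt W p) :
    ∀ (W : WeierstrassCurve ℚ) [W.IsElliptic] [W.IsGloballyMinimal] (p : ℕ) [Fact p.Prime],
      W.analyticRank = 1 → p ≠ 2 → ClassX3 W p → Additive.SubGordTwo W p → MissingPPartAt W p :=
  fun W _ _ p _ hr hp2 hX hG ↦ missingPPartAt_of_lower_of_upper W p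
    (missingLowerBoundAt_gordTwo_of_KYRead hF hCF hR hKY hCH hSl W p hr hp2 hX hG)
    (Upper.missingUpperBoundAt_gordTwo_of_KYRead_of_twistUnitField hF hCF hR hKY hCHu hSlU hTU W p hr hp2 hX hG)

end Summit.BirchSwinnertonDyer.BirchSwinnertonDyer.Theorems.SchneiderFreeAdditiveX3

end
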